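import Mathlib.Analysis.Complex.RemovableSingularity
import Mathlib.Topology.MetricSpace.Holder
import Literature.Probability.RandomPlanarGeometry.ConformalMap
import HarnessLib

/-!
# Conformal removability inside a planar domain (Jones–Smirnov 2000, Def. 1)

P. W. Jones, S. K. Smirnov, *Removability theorems for Sobolev functions and quasiconformal maps*,
Ark. Mat. 38 (2000) 263–279 [`JonesSmirnov2000`], p. 263: "**Definition 1.** We say that a compact
set `K ⊂ U` is (quasi)conformally removable inside a domain `U`, if any homeomorphism of `U`, which
is (quasi)conformal on `U ∖ K`, is (quasi)conformal on `U`." (p. 264: "for planar sets properties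
of conformal and quasiconformal removability are equivalent"; "the union of two disjoint compacta
is (quasi)conformally removable if and only if both of them are. However, the latter does not seem
to be known if their intersection is non-empty"; p. 266: "A simply connected domain in the complex
plane is called Hölder if the Riemann uniformization map is Hölder-continuous in the closed unit
disc"; p. 267: "**Corollary 2.** Boundaries of Hölder domains are quasiconformally removable.")

## Contents

* `IsConformallyRemovableIn Ω K` — the notion, for arbitrary `Ω K : Set ℂ` (only `K ∩ Ω` matters,
  `iff_inter`): every map `F : ℂ → ℂ` continuous and injective on `Ω` and holomorphic
  (`DifferentiableOn ℂ`) on `Ω ∖ K` is holomorphic on `Ω`. For an open `Ω ⊆ ℂ` a continuous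
  injection `Ω → ℂ` is a homeomorphism onto its (open) image (invariance of domain), and an
  injective map is conformal iff holomorphic, so this is Jones–Smirnov's Def. 1 with the maps
  spelled out; the route `CriticalPhenomena/SAWWeldingIdentification` inlines the weaker clause
  with self-maps `F(Ω) = Ω` only, which the notion implies (`self_maps`).
  `IsConformallyRemovable K` is the whole-plane case `Ω = univ` (homeomorphisms of `ℂ` conformal
  off `K` are conformal, the form used for SLE/LQG weldings).
* Proved API: `empty`, `anti` (subsets of removable sets are removable), `iff_inter`,
  `of_inter_eq_empty`, `self_maps`, LOCALITY `of_forall_nhds` / `iff_forall_nhds` (for `Ω` open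
  and `K` closed: removable in `Ω` iff every point of `K ∩ Ω` has an open neighbourhood `U ⊆ Ω`
  with `K` removable in `U`), CONFORMAL INVARIANCE `image_conformalEquiv` (images under the tree's
  `ConformalEquiv`), and the elementary examples `singleton` (Riemann's removable singularity
  theorem, Mathlib) and `of_finite`.
* `IsHolderDomain Ω` (a conformal equivalence from the unit disc onto `Ω` that is Hölder
  continuous on the disc; `isHolderDomain_ball`) and the NAMED FACT
  `JonesSmirnov2000_frontier_of_isHolderDomain` (Cor. 2: boundaries of Hölder domains are
  conformally removable inside every domain containing them).

## Not here

Unions: only the disjoint/separated case follows from locality (`of_forall_nhds`); the union of two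
intersecting removable compacta is an open problem (Jones–Smirnov p. 264), so no union lemma is
stated. Independence of the reference domain for compact `K` ("standard extension theorems",
p. 264), John domains (Cor. 1), the `W^{1,2}`-removability route (Thms. 1–3) and the SLE
application (Rohde–Schramm 2005 Thm. 5.2 + Cor. 2 ⇒ SLE_κ traces, `κ < 4`, are a.s. removable) are
left to their own cite items.

## References

* [JonesSmirnov2000] P. W. Jones, S. K. Smirnov, Ark. Mat. 38 (2000) 263–279, Def. 1 (p. 263),
  p. 264, p. 266 (Hölder domains), Cor. 2 (p. 267). doi:10.1007/BF02384320.
* [Younsi2018] M. Younsi, Ann. Acad. Sci. Fenn. Math. 43 (2018) 463–473 (removability and conformal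
  welding).
-/

noncomputable section

open Set Filter Metric
open scoped _root_.Topology NNReal

namespace Literature.Probability.RandomPlanarGeometry

/-! ### The notion -/

/-- **Conformal removability inside `Ω`** (Jones–Smirnov 2000, Def. 1: "a compact set `K ⊂ U` is
(quasi)conformally removable inside a domain `U`, if any homeomorphism of `U`, which is
(quasi)conformal on `U ∖ K`, is (quasi)conformal on `U`"), for arbitrary `Ω K : Set ℂ`: every
`F : ℂ → ℂ` continuous and injective on `Ω` (for open `Ω`, a homeomorphism onto its image) and
holomorphic on `Ω ∖ K` is holomorphic on `Ω`. Only `K ∩ Ω` matters (`iff_inter`).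
[cite: JonesSmirnov2000, Def. 1 (p. 263)] -/
def IsConformallyRemovableIn (Ω K : Set ℂ) : Prop :=
  ∀ F : ℂ → ℂ, ContinuousOn F Ω → InjOn F Ω → DifferentiableOn ℂ F (Ω \ K) →
    DifferentiableOn ℂ F Ω

/-- **Conformal removability** of `K ⊆ ℂ` (the whole-plane case `Ω = ℂ`): every injective
continuous `F : ℂ → ℂ` holomorphic off `K` is entire (hence, being injective, affine) — the notion
used for SLE traces and LQG conformal weldings. [cite: JonesSmirnov2000, Def. 1 (p. 263)] -/
abbrev IsConformallyRemovable (K : Set ℂ) : Prop :=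
  IsConformallyRemovableIn univ K

namespace IsConformallyRemovableIn

variable {Ω K K' U V : Set ℂ}

/-- The empty set is removable. [folklore] -/
theorem empty (Ω : Set ℂ) : IsConformallyRemovableIn Ω ∅ :=
  fun _ _ _ hd => by rwa [sdiff_empty] at hd

/-- **Subsets of removable sets are removable** (antitonicity in `K`). [folklore] -/
theorem anti (h : IsConformallyRemovableIn Ω K) (hK : K' ⊆ K) : IsConformallyRemovableIn Ω K' :=
  fun F hc hi hd => h F hc hi (hd.mono (sdiff_subset_sdiff_right hK))

/-- Only the part of `K` inside `Ω` matters. [folklore] -/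
theorem iff_inter : IsConformallyRemovableIn Ω K ↔ IsConformallyRemovableIn Ω (K ∩ Ω) := by
  simp only [IsConformallyRemovableIn, sdiff_inter_self_eq_sdiff]

/-- A set that does not meet `Ω` is removable in `Ω`. [folklore] -/
theorem of_inter_eq_empty (h : K ∩ Ω = ∅) : IsConformallyRemovableIn Ω K := by
  rw [iff_inter, h]
  exact empty Ω

/-- The clause inlined by the route `CriticalPhenomena/SAWWeldingIdentification` (self-maps of `Ω`
onto `Ω` only) follows from removability. [folklore] -/
theorem self_maps (h : IsConformallyRemovableIn Ω K) :
    ∀ F : ℂ → ℂ, ContinuousOn F Ω → InjOn F Ω → F '' Ω = Ω → DifferentiableOn ℂ F (Ω \ K) →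
      DifferentiableOn ℂ F Ω :=
  fun F hc hi _ hd => h F hc hi hd

/-! ### Locality -/

/-- **Locality, the non-trivial direction**: for `Ω` open and `K` closed, if every point of
`K ∩ Ω` has an open neighbourhood `U ⊆ Ω` inside which `K` is removable, then `K` is removable
inside `Ω` (holomorphy is local; off `K` nothing is to be proved since `Ω ∖ K` is open). In
particular separated unions of closed removable sets are removable (Jones–Smirnov p. 264, disjoint
compacta). [folklore] -/
theorem of_forall_nhds (hΩ : IsOpen Ω) (hK : IsClosed K)
    (h : ∀ z ∈ K ∩ Ω, ∃ U : Set ℂ, IsOpen U ∧ z ∈ U ∧ U ⊆ Ω ∧ IsConformallyRemovableIn U K) :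
    IsConformallyRemovableIn Ω K := by
  intro F hc hi hd z hz
  by_cases hzK : z ∈ K
  · obtain ⟨U, hU, hzU, hUΩ, hrem⟩ := h z ⟨hzK, hz⟩
    have hFU := hrem F (hc.mono hUΩ) (hi.mono hUΩ) (hd.mono (sdiff_subset_sdiff_left hUΩ))
    exact (hFU.differentiableAt (hU.mem_nhds hzU)).differentiableWithinAt
  · exact (hd.differentiableAt ((hΩ.sdiff hK).mem_nhds ⟨hz, hzK⟩)).differentiableWithinAt

/-- **Locality**: for `Ω` open and `K` closed, `K` is removable inside `Ω` iff every point of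
`K ∩ Ω` has an open neighbourhood `U ⊆ Ω` inside which `K` is removable (the forward direction
takes `U = Ω`). [folklore] -/
theorem iff_forall_nhds (hΩ : IsOpen Ω) (hK : IsClosed K) :
    IsConformallyRemovableIn Ω K ↔
      ∀ z ∈ K ∩ Ω, ∃ U : Set ℂ, IsOpen U ∧ z ∈ U ∧ U ⊆ Ω ∧ IsConformallyRemovableIn U K :=
  ⟨fun h _ hz => ⟨Ω, hΩ, hz.2, Subset.rfl, h⟩, of_forall_nhds hΩ hK⟩

/-! ### Conformal invariance -/

/-- **Conformal invariance**: if `K` is removable inside `U` and `φ : U → V` is a conformal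
equivalence, then `φ(K ∩ U)` is removable inside `V` (pull a test map `G` on `V` back to `G ∘ φ`
on `U`, then push forward with the holomorphic inverse; Jones–Smirnov p. 264: "the property of
quasiconformal removability is quasiconformally invariant"). [cite: JonesSmirnov2000, p. 264] -/
theorem image_conformalEquiv (h : IsConformallyRemovableIn U K) (φ : ConformalEquiv U V) :
    IsConformallyRemovableIn V (φ '' (K ∩ U)) := by
  intro G hGc hGi hGd
  have hFc : ContinuousOn (G ∘ φ) U := hGc.comp φ.continuousOn φ.mapsTo
  have hFi : InjOn (G ∘ φ) U := hGi.comp φ.injOn φ.mapsTo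
  have hmaps : MapsTo φ (U \ K) (V \ φ '' (K ∩ U)) := by
    intro z hz
    refine ⟨φ.mapsTo hz.1, ?_⟩
    rintro ⟨k, hk, hkz⟩
    exact hz.2 (φ.injOn hk.2 hz.1 hkz ▸ hk.1)
  have hFd : DifferentiableOn ℂ (G ∘ φ) (U \ K) :=
    hGd.comp (φ.differentiableOn_coe.mono sdiff_subset) hmaps
  have hF := h _ hFc hFi hFd
  have hG' : DifferentiableOn ℂ ((G ∘ φ) ∘ φ.symm) V :=
    hF.comp φ.symm.differentiableOn_coe φ.symm_mapsTo
  exact hG'.congr fun y hy => by simp [φ.apply_symm_apply hy]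

/-! ### Elementary examples -/

/-- **A point is removable** inside an open set (Riemann's removable singularity theorem: holomorphic
on `Ω ∖ {a}` and continuous at `a` implies holomorphic on `Ω`; Mathlib's
`Complex.differentiableOn_compl_singleton_and_continuousAt_iff`; injectivity is not needed).
[folklore] -/
theorem singleton (hΩ : IsOpen Ω) (a : ℂ) : IsConformallyRemovableIn Ω {a} := by
  intro F hc _ hd
  by_cases ha : a ∈ Ω
  · exact (Complex.differentiableOn_compl_singleton_and_continuousAt_iff (hΩ.mem_nhds ha)).mp
      ⟨hd, hc.continuousAt (hΩ.mem_nhds ha)⟩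
  · rwa [sdiff_singleton_eq_self ha] at hd

/-- **Finite sets are removable** inside an open set (locality + `singleton`; the trivial case of
"any set of σ-finite length is conformally removable", Jones–Smirnov p. 264). [folklore] -/
theorem of_finite (hΩ : IsOpen Ω) {S : Set ℂ} (hS : S.Finite) : IsConformallyRemovableIn Ω S := by
  refine of_forall_nhds hΩ hS.isClosed fun a ha => ?_
  -- an open neighbourhood of `a` inside `Ω` meeting `S` only at `a`
  have hT : IsClosed (S \ {a}) := (hS.subset sdiff_subset).isClosed
  refine ⟨Ω ∩ (S \ {a})ᶜ, hΩ.inter hT.isOpen_compl, ⟨ha.2, fun h => h.2 rfl⟩, inter_subset_left, ?_⟩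
  rw [iff_inter]
  have hSU : S ∩ (Ω ∩ (S \ {a})ᶜ) ⊆ {a} := by
    rintro z ⟨hzS, -, hz⟩
    by_contra hza
    exact hz ⟨hzS, hza⟩
  exact (singleton (hΩ.inter hT.isOpen_compl) a).anti hSU

end IsConformallyRemovableIn

/-! ### Hölder domains and Jones–Smirnov's Corollary 2 -/

/-- A **Hölder domain**: a (simply connected, planar) domain whose Riemann uniformisation map from
the unit disc is Hölder continuous up to the boundary — here: some conformal equivalence from
`ball 0 1` onto `Ω` is Hölder continuous on the open disc (equivalently on the closed disc, by
uniform continuity) (Jones–Smirnov 2000, p. 266: "A simply connected domain in the complex plane is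
called Hölder if the Riemann uniformization map is Hölder-continuous in the closed unit disc").
[cite: JonesSmirnov2000, p. 266] -/
def IsHolderDomain (Ω : Set ℂ) : Prop :=
  ∃ (φ : ConformalEquiv (ball (0 : ℂ) 1) Ω) (C α : ℝ≥0), 0 < α ∧ HolderOnWith C α φ (ball (0 : ℂ) 1)

/-- The unit disc is a Hölder domain (the identity is Lipschitz). [folklore] -/
theorem isHolderDomain_ball : IsHolderDomain (ball (0 : ℂ) 1) := by
  refine ⟨ConformalEquiv.refl _, 1, 1, one_pos, ?_⟩
  have : (⇑(ConformalEquiv.refl (ball (0 : ℂ) 1)) : ℂ → ℂ) = id :=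
    funext (ConformalEquiv.refl_apply _)
  rw [this]
  exact (LipschitzWith.id.lipschitzOnWith).holderOnWith

/-- **Jones–Smirnov 2000, Corollary 2** ("Boundaries of Hölder domains are quasiconformally
removable"; for planar sets quasiconformal and conformal removability are equivalent, p. 264; the
reference domain is any domain containing the compact set, Def. 1 and p. 264): for every Hölder
domain `Ω` and every domain (open connected) `U ⊇ ∂Ω`, the boundary `frontier Ω` is conformally
removable inside `U`. Proved there via `W^{1,2}`-removability (Thm. 3, Cor. 4). Combined with
Rohde–Schramm 2005 Thm. 5.2 (complements of SLE_κ hulls, `κ ≠ 4`, are Hölder domains) it yields the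
a.s. removability of SLE_κ traces, `κ < 4`. [cite: JonesSmirnov2000, Cor. 2 (p. 267)] -/
def JonesSmirnov2000_frontier_of_isHolderDomain : Prop :=
  ∀ ⦃Ω : Set ℂ⦄, IsHolderDomain Ω → ∀ ⦃U : Set ℂ⦄, IsOpen U → IsConnected U → frontier Ω ⊆ U →
    IsConformallyRemovableIn U (frontier Ω)

end Literature.Probability.RandomPlanarGeometry

end
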